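import Literature.Geometry.Lorentzian.KerrDeSitterRadialTSLadderThreeHalves
import HarnessLib

/-!
# Half-integer spin `|s| = 3/2` on the real axis, VII: the reflection–duality map (spin `−3/2` to
# spin `+3/2` of the reflected quartic)

The spin-`(−3/2)` case is REDUCED to the generic spin-`(+3/2)` lemmas of files II, III and V by the
map `S(t) := Δ(−t)^{−3/2}·R(−t)`: if `R` solves the generic spin-`(−3/2)` equation
`Δ²R″ − (1/2)ΔΔ′R′ + N₋R = 0`, `N₋ = K̃² + (3i/2)K̃Δ′ + Δ(−3iK̃′ + Δ″/6 − λ̃)`, at `y`, then `S`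
solves at `−y` the spin-`(+3/2)` equation of files I–V for the REFLECTED quartic `Δ̃(t) = Δ(−t)`
(`d₁ ↦ −d₁`), with the same `K̃` and `λ̃` (`tsq_dual_ode`). (Wu–Yan's duality
`R_{−s} ↦ Δ^{−s}·conj R_{−s}` composed with `t ↦ −t` and complex conjugation, both of which preserve
the generic equation; the composite involves no conjugation.) Under this map the ingoing branch
at `r₊` becomes the regular branch at `−r₊` approached from the left and the outgoing branch at
`r_c` the singular branch at `−r_c` approached from the right, so `tendsto_tsqForm_regular` and
`tendsto_tsqForm_singular` apply verbatim (`tsqDual_regular_branch`, `tsqDual_singular_branch`).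
This file contains the pointwise map and the branch conversions only (no statement about radial
solutions vanishing). Definitions with bodies + theorems, NO named facts.

Sources: [WuYan2004] Appendix A (A4); [SuzukiTakasugiUmetsu1998] (3.7) (the radial equation at
spin `−3/2`); [CasalsTeixeiradacosta2022] Theorem 3.10.
-/

noncomputable section

open Complex Set Filter Topology

open scoped ComplexConjugate

namespace Literature.Geometry.Lorentzian.KerrDeSitter

/-! ### The spin-`(−3/2)` numerator and the reflected quartic -/

/-- Real part of the numerator `N₋ = Δ·V₋` of the generic spin-`(−3/2)` radial coefficient:
`Re N₋ = K̃² + Δ(Δ″/6 − λ̃)`. [cite: SuzukiTakasugiUmetsu1998, (3.7)] -/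
def tsqNMre (d₀ d₁ d₂ d₄ k₀ k₂ el r : ℝ) : ℝ :=
  tsqK k₀ k₂ r ^ 2 + tsqDelta d₀ d₁ d₂ d₄ r * (tsqDeltaDD d₂ d₄ r / 6 - el)

/-- Imaginary part of the numerator `N₋ = Δ·V₋` of the generic spin-`(−3/2)` radial coefficient:
`Im N₋ = (3/2)K̃Δ′ − 3ΔK̃′`. [cite: SuzukiTakasugiUmetsu1998, (3.7)] -/
def tsqNMim (d₀ d₁ d₂ d₄ k₀ k₂ r : ℝ) : ℝ :=
  3 / 2 * tsqK k₀ k₂ r * tsqDeltaD d₁ d₂ d₄ r - tsqDelta d₀ d₁ d₂ d₄ r * (3 * (2 * k₂ * r))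

/-- Reflection of the even quartic: `Δ(−t)` is the quartic with `d₁ ↦ −d₁`.
[cite: Hatsuda2020, (2.13)] -/
theorem tsqDelta_neg (d₀ d₁ d₂ d₄ t : ℝ) :
    tsqDelta d₀ d₁ d₂ d₄ (-t) = tsqDelta d₀ (-d₁) d₂ d₄ t := by
  unfold tsqDelta; ring

/-- `Δ′(−t) = −Δ̃′(t)` for the reflected quartic `Δ̃`. [cite: Hatsuda2020, (2.13)] -/
theorem tsqDeltaD_neg (d₁ d₂ d₄ t : ℝ) :
    tsqDeltaD d₁ d₂ d₄ (-t) = -tsqDeltaD (-d₁) d₂ d₄ t := by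
  unfold tsqDeltaD; ring

/-- `Δ″(−t) = Δ̃″(t)`. [cite: Hatsuda2020, (2.13)] -/
theorem tsqDeltaDD_neg (d₂ d₄ t : ℝ) : tsqDeltaDD d₂ d₄ (-t) = tsqDeltaDD d₂ d₄ t := by
  unfold tsqDeltaDD; ring

/-- `K̃(−t) = K̃(t)`. [cite: Hatsuda2020, (2.14)] -/
theorem tsqK_neg (k₀ k₂ t : ℝ) : tsqK k₀ k₂ (-t) = tsqK k₀ k₂ t := by
  unfold tsqK; ring

/-! ### The map `S(t) = Δ(−t)^{−3/2}·R(−t)` and its derivatives -/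

/-- The weight `T(t) = Δ(−t)^{−3/2}` of the reflection–duality map.
[cite: WuYan2004, Appendix A, (A4)] -/
def tsqDualT (d₀ d₁ d₂ d₄ t : ℝ) : ℝ := tsqDelta d₀ d₁ d₂ d₄ (-t) ^ (-(3 / 2 : ℝ))

/-- **The reflection–duality map** `S(t) = Δ(−t)^{−3/2}·R(−t)`.
[cite: WuYan2004, Appendix A, (A4)] -/
def tsqDual (d₀ d₁ d₂ d₄ : ℝ) (R : ℝ → ℂ) (t : ℝ) : ℂ := (tsqDualT d₀ d₁ d₂ d₄ t : ℂ) * R (-t)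

/-- The first derivative of the reflection–duality map in terms of `R`, `R′`:
`S′(t) = T(t)·((3/2)(Δ′/Δ)(−t)·R(−t) − R′(−t))`. [cite: WuYan2004, Appendix A, (A4)] -/
def tsqDualD (d₀ d₁ d₂ d₄ : ℝ) (R R' : ℝ → ℂ) (t : ℝ) : ℂ :=
  (tsqDualT d₀ d₁ d₂ d₄ t : ℂ) *
    (((3 / 2 * tsqDeltaD d₁ d₂ d₄ (-t) / tsqDelta d₀ d₁ d₂ d₄ (-t) : ℝ) : ℂ) * R (-t) - R' (-t))

/-- The second derivative of the reflection–duality map in terms of `R`, `R′`, `R″`: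
`S″(t) = T(t)·(R″ − 3(Δ′/Δ)R′ + ((15/4)Δ′² − (3/2)ΔΔ″)/Δ²·R)(−t)`.
[cite: WuYan2004, Appendix A, (A4)] -/
def tsqDualDD (d₀ d₁ d₂ d₄ : ℝ) (R R' R'' : ℝ → ℂ) (t : ℝ) : ℂ :=
  (tsqDualT d₀ d₁ d₂ d₄ t : ℂ) * (R'' (-t) -
    ((3 * tsqDeltaD d₁ d₂ d₄ (-t) / tsqDelta d₀ d₁ d₂ d₄ (-t) : ℝ) : ℂ) * R' (-t) +
    (((15 / 4 * tsqDeltaD d₁ d₂ d₄ (-t) ^ 2 -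
        3 / 2 * tsqDelta d₀ d₁ d₂ d₄ (-t) * tsqDeltaDD d₂ d₄ (-t)) /
        tsqDelta d₀ d₁ d₂ d₄ (-t) ^ 2 : ℝ) : ℂ) * R (-t))

/-- The derivative of the weight: `T′(t) = (3/2)(Δ′/Δ)(−t)·T(t)` where `Δ(−t) > 0`.
[cite: WuYan2004, Appendix A, (A4)] -/
theorem hasDerivAt_tsqDualT {d₀ d₁ d₂ d₄ : ℝ} {t : ℝ} (hΔ : 0 < tsqDelta d₀ d₁ d₂ d₄ (-t)) :
    HasDerivAt (fun u => tsqDualT d₀ d₁ d₂ d₄ u)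
      (3 / 2 * tsqDeltaD d₁ d₂ d₄ (-t) / tsqDelta d₀ d₁ d₂ d₄ (-t) * tsqDualT d₀ d₁ d₂ d₄ t) t := by
  have hΔn : HasDerivAt (fun u => tsqDelta d₀ d₁ d₂ d₄ (-u)) (-tsqDeltaD d₁ d₂ d₄ (-t)) t := by
    have h := (hasDerivAt_tsqDelta d₀ d₁ d₂ d₄ (-t)).comp t (hasDerivAt_neg t)
    simp only [Function.comp_def, mul_neg, mul_one] at h
    exact h
  have h := hΔn.rpow_const (p := -(3 / 2 : ℝ)) (Or.inl hΔ.ne')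
  unfold tsqDualT
  refine h.congr_deriv ?_
  rw [Real.rpow_sub_one hΔ.ne']
  field_simp

/-- The reflection–duality map is differentiable where `R` is, with derivative `tsqDualD`.
[cite: WuYan2004, Appendix A, (A4)] -/
theorem hasDerivAt_tsqDual {d₀ d₁ d₂ d₄ : ℝ} {R R' : ℝ → ℂ} {t : ℝ}
    (hΔ : 0 < tsqDelta d₀ d₁ d₂ d₄ (-t)) (h1 : HasDerivAt R (R' (-t)) (-t)) :
    HasDerivAt (fun u => tsqDual d₀ d₁ d₂ d₄ R u) (tsqDualD d₀ d₁ d₂ d₄ R R' t) t := by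
  have hT := (hasDerivAt_tsqDualT hΔ).ofReal_comp
  have hRn : HasDerivAt (fun u => R (-u)) (-R' (-t)) t := by
    have h := h1.scomp t (hasDerivAt_neg t)
    simp only [Function.comp_def, neg_smul, one_smul] at h
    exact h
  have h := hT.fun_mul hRn
  unfold tsqDual tsqDualD
  refine h.congr_deriv ?_
  push_cast
  ring

/-- The first derivative `tsqDualD` is differentiable where `R′` is, with derivative `tsqDualDD`.
[cite: WuYan2004, Appendix A, (A4)] -/
theorem hasDerivAt_tsqDualD {d₀ d₁ d₂ d₄ : ℝ} {R R' R'' : ℝ → ℂ} {t : ℝ}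
    (hΔ : 0 < tsqDelta d₀ d₁ d₂ d₄ (-t)) (h1 : HasDerivAt R (R' (-t)) (-t))
    (h2 : HasDerivAt R' (R'' (-t)) (-t)) :
    HasDerivAt (fun u => tsqDualD d₀ d₁ d₂ d₄ R R' u) (tsqDualDD d₀ d₁ d₂ d₄ R R' R'' t) t := by
  have hΔne : tsqDelta d₀ d₁ d₂ d₄ (-t) ≠ 0 := hΔ.ne'
  have hT := (hasDerivAt_tsqDualT hΔ).ofReal_comp
  have hRn : HasDerivAt (fun u => R (-u)) (-R' (-t)) t := by
    have h := h1.scomp t (hasDerivAt_neg t)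
    simp only [Function.comp_def, neg_smul, one_smul] at h
    exact h
  have hR'n : HasDerivAt (fun u => R' (-u)) (-R'' (-t)) t := by
    have h := h2.scomp t (hasDerivAt_neg t)
    simp only [Function.comp_def, neg_smul, one_smul] at h
    exact h
  have hΔn : HasDerivAt (fun u => tsqDelta d₀ d₁ d₂ d₄ (-u)) (-tsqDeltaD d₁ d₂ d₄ (-t)) t := by
    have h := (hasDerivAt_tsqDelta d₀ d₁ d₂ d₄ (-t)).comp t (hasDerivAt_neg t)
    simp only [Function.comp_def, mul_neg, mul_one] at h
    exact h
  have hDn : HasDerivAt (fun u => tsqDeltaD d₁ d₂ d₄ (-u)) (-tsqDeltaDD d₂ d₄ (-t)) t := by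
    have h := (hasDerivAt_tsqDeltaD d₁ d₂ d₄ (-t)).comp t (hasDerivAt_neg t)
    simp only [Function.comp_def, mul_neg, mul_one] at h
    exact h
  -- the ratio `(3/2)Δ′/Δ` along `−u`
  have hq : HasDerivAt
      (fun u => ((3 / 2 * tsqDeltaD d₁ d₂ d₄ (-u) / tsqDelta d₀ d₁ d₂ d₄ (-u) : ℝ) : ℂ))
      ((((3 / 2 * (-tsqDeltaDD d₂ d₄ (-t)) * tsqDelta d₀ d₁ d₂ d₄ (-t) -
          3 / 2 * tsqDeltaD d₁ d₂ d₄ (-t) * (-tsqDeltaD d₁ d₂ d₄ (-t))) /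
          tsqDelta d₀ d₁ d₂ d₄ (-t) ^ 2 : ℝ)) : ℂ) t :=
    ((hDn.const_mul (3 / 2)).div hΔn hΔne).ofReal_comp
  have h := hT.fun_mul ((hq.fun_mul hRn).fun_sub hR'n)
  unfold tsqDualD tsqDualDD
  refine h.congr_deriv ?_
  have hΔc : (tsqDelta d₀ d₁ d₂ d₄ (-t) : ℂ) ≠ 0 := by exact_mod_cast hΔne
  push_cast
  field_simp
  ring

/-- **The reflection–duality map solves the spin-`(+3/2)` equation of the reflected quartic.** If
`Δ(y) > 0` and `Δ²R″ − (1/2)ΔΔ′R′ + N₋R = 0` at `y` (generic spin-`(−3/2)` equation, real data),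
then at `t = −y`: `Δ̃(t)²S″(t) + (5/2)Δ̃(t)Δ̃′(t)S′(t) + N₊(t)S(t) = 0` with `Δ̃ = Δ(−·)` the
reflected quartic (`d₁ ↦ −d₁`) and `N₊ = tsqNVre + i·tsqNVim` of the reflected data, same `K̃`,
`λ̃`. [cite: WuYan2004, Appendix A, (A4)] -/
theorem tsq_dual_ode {d₀ d₁ d₂ d₄ k₀ k₂ el : ℝ} {R R' R'' : ℝ → ℂ} {y : ℝ}
    (hΔ : 0 < tsqDelta d₀ d₁ d₂ d₄ y)
    (heq : (tsqDelta d₀ d₁ d₂ d₄ y : ℂ) ^ 2 * R'' y -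
      1 / 2 * (tsqDelta d₀ d₁ d₂ d₄ y : ℂ) * (tsqDeltaD d₁ d₂ d₄ y : ℂ) * R' y +
        ((tsqNMre d₀ d₁ d₂ d₄ k₀ k₂ el y : ℂ) + I * (tsqNMim d₀ d₁ d₂ d₄ k₀ k₂ y : ℂ)) * R y = 0) :
    (tsqDelta d₀ (-d₁) d₂ d₄ (-y) : ℂ) ^ 2 * tsqDualDD d₀ d₁ d₂ d₄ R R' R'' (-y) +
      5 / 2 * (tsqDelta d₀ (-d₁) d₂ d₄ (-y) : ℂ) * (tsqDeltaD (-d₁) d₂ d₄ (-y) : ℂ) *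
          tsqDualD d₀ d₁ d₂ d₄ R R' (-y) +
        ((tsqNVre d₀ (-d₁) d₂ d₄ k₀ k₂ el (-y) : ℂ) + I * (tsqNVim d₀ (-d₁) d₂ d₄ k₀ k₂ (-y) : ℂ)) *
          tsqDual d₀ d₁ d₂ d₄ R (-y) = 0 := by
  have hΔc : (tsqDelta d₀ d₁ d₂ d₄ y : ℂ) ≠ 0 := by exact_mod_cast hΔ.ne'
  have hD' : tsqDeltaD (-d₁) d₂ d₄ (-y) = -tsqDeltaD d₁ d₂ d₄ y := by
    unfold tsqDeltaD; ring
  unfold tsqDualDD tsqDualD tsqDual tsqDualT tsqNVre tsqNVim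
  simp only [tsqDelta_neg, hD', tsqDeltaDD_neg, tsqK_neg, neg_neg]
  unfold tsqNMre tsqNMim at heq
  push_cast at heq ⊢
  field_simp
  linear_combination (48 * ((tsqDelta d₀ d₁ d₂ d₄ y ^ (-(3 / 2 : ℝ)) : ℝ) : ℂ)) * heq

/-! ### The cofactor of a simple root, and the two branch conversions under the duality map -/

/-- The cubic cofactor of a root `q` of the even quartic: `Δ(x) = (x − q)·σ_q(x)` when `Δ(q) = 0`
(`tsqDelta_eq_mul_tsqCofactor`), `σ_q(q) = Δ′(q)`. [cite: Hatsuda2020, (2.13)] -/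
def tsqCofactor (d₁ d₂ d₄ q x : ℝ) : ℝ :=
  d₁ + d₂ * (x + q) + d₄ * (x ^ 3 + x ^ 2 * q + x * q ^ 2 + q ^ 3)

/-- `Δ(x) = (x − q)·σ_q(x)` at a root `q`. [cite: Hatsuda2020, (2.13)] -/
theorem tsqDelta_eq_mul_tsqCofactor {d₀ d₁ d₂ d₄ q : ℝ} (hq : tsqDelta d₀ d₁ d₂ d₄ q = 0)
    (x : ℝ) : tsqDelta d₀ d₁ d₂ d₄ x = (x - q) * tsqCofactor d₁ d₂ d₄ q x := by
  unfold tsqCofactor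
  unfold tsqDelta at hq ⊢
  linear_combination hq

/-- `σ_q(q) = Δ′(q)`. [cite: Hatsuda2020, (2.13)] -/
theorem tsqCofactor_self (d₁ d₂ d₄ q : ℝ) :
    tsqCofactor d₁ d₂ d₄ q q = tsqDeltaD d₁ d₂ d₄ q := by
  unfold tsqCofactor tsqDeltaD; ring

/-- The cofactor is smooth (a cubic polynomial). [cite: Hatsuda2020, (2.13)] -/
theorem contDiff_tsqCofactor (d₁ d₂ d₄ q : ℝ) {n : WithTop ℕ∞} :
    ContDiff ℝ n (fun x => tsqCofactor d₁ d₂ d₄ q x) := by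
  unfold tsqCofactor; fun_prop

/-- A sign of the cofactor at the root persists on a neighbourhood (continuity of the cubic).
[cite: Hatsuda2020, (2.13)] -/
theorem exists_tsqCofactor_sign {d₁ d₂ d₄ q c : ℝ} (hc : 0 < c * tsqCofactor d₁ d₂ d₄ q q) :
    ∃ δ : ℝ, 0 < δ ∧ ∀ x ∈ Ioo (q - δ) (q + δ), 0 < c * tsqCofactor d₁ d₂ d₄ q x := by
  have hcont : Continuous fun x => c * tsqCofactor d₁ d₂ d₄ q x :=
    continuous_const.mul (contDiff_tsqCofactor d₁ d₂ d₄ q (n := 0)).continuous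
  have hev : ∀ᶠ x in 𝓝 q, 0 < c * tsqCofactor d₁ d₂ d₄ q x :=
    hcont.continuousAt.eventually (lt_mem_nhds hc)
  obtain ⟨δ, hδ, h⟩ := Metric.eventually_nhds_iff.1 hev
  refine ⟨δ, hδ, fun x hx => h ?_⟩
  rw [Real.dist_eq, abs_lt]
  exact ⟨by linarith [hx.1], by linarith [hx.2]⟩

/-- `Δ̃′` of the reflected quartic at `−t` is `−Δ′(t)`. [cite: Hatsuda2020, (2.13)] -/
theorem tsqDeltaD_reflect (d₁ d₂ d₄ t : ℝ) :
    tsqDeltaD (-d₁) d₂ d₄ (-t) = -tsqDeltaD d₁ d₂ d₄ t := by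
  unfold tsqDeltaD; ring

/-- **Singular-branch conversion.** At a root `q` approached from the left along a branch
`R(x)·(q − x)^{−iγ} = g(x)` on `(q − ε, q)` (the outgoing branch at `r_c`), with `σ_q < 0` there,
the dual function satisfies on `(−q, −q + ε)` the singular-branch relation of file V at `p = −q`:
`S(t)·(t − p)^{3/2 + i(−γ)} = (−σ_q(−t))^{−3/2}·g(−t)`. [cite: WuYan2004, Appendix A, (A4);
CasalsTeixeiradacosta2022, Definition 3.3] -/
theorem tsqDual_singular_branch {d₀ d₁ d₂ d₄ q γ ε : ℝ} (hq : tsqDelta d₀ d₁ d₂ d₄ q = 0)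
    {R g : ℝ → ℂ} (hRg : ∀ x ∈ Ioo (q - ε) q, R x * ((q - x : ℝ) : ℂ) ^ (-(I * (γ : ℂ))) = g x)
    (hσ : ∀ x ∈ Ioo (q - ε) q, tsqCofactor d₁ d₂ d₄ q x < 0) {t : ℝ}
    (ht : t ∈ Ioo (-q) (-q + ε)) :
    tsqDual d₀ d₁ d₂ d₄ R t * ((t - -q : ℝ) : ℂ) ^ ((((3 / 2 : ℝ)) : ℂ) + I * (((-γ : ℝ)) : ℂ)) =
      (((-tsqCofactor d₁ d₂ d₄ q (-t)) ^ (-(3 / 2 : ℝ)) : ℝ) : ℂ) * g (-t) := by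
  obtain ⟨ht1, ht2⟩ := ht
  have hx : -t ∈ Ioo (q - ε) q := ⟨by linarith, by linarith⟩
  obtain ⟨u, hu_def⟩ : ∃ u : ℝ, u = t - -q := ⟨_, rfl⟩
  have hu : 0 < u := by rw [hu_def]; linarith
  obtain ⟨τ, hτ_def⟩ : ∃ τ : ℝ, τ = -tsqCofactor d₁ d₂ d₄ q (-t) := ⟨_, rfl⟩
  have hτ : 0 < τ := by rw [hτ_def]; linarith [hσ (-t) hx]
  have hΔx : tsqDelta d₀ d₁ d₂ d₄ (-t) = u * τ := by
    rw [tsqDelta_eq_mul_tsqCofactor hq, hu_def, hτ_def]; ring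
  have hT : tsqDualT d₀ d₁ d₂ d₄ t = u ^ (-(3 / 2 : ℝ)) * τ ^ (-(3 / 2 : ℝ)) := by
    unfold tsqDualT; rw [hΔx]; exact Real.mul_rpow hu.le hτ.le
  have huc : ((u : ℝ) : ℂ) ≠ 0 := by exact_mod_cast hu.ne'
  have hg := hRg (-t) hx
  rw [show q - -t = u by rw [hu_def]; ring,
    show -(I * (γ : ℂ)) = I * (((-γ : ℝ)) : ℂ) by push_cast; ring] at hg
  have h32 : ((u : ℝ) : ℂ) ^ ((((3 / 2 : ℝ)) : ℂ)) = ((u ^ (3 / 2 : ℝ) : ℝ) : ℂ) :=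
    (Complex.ofReal_cpow hu.le _).symm
  have hinv : ((u ^ (-(3 / 2 : ℝ)) : ℝ) : ℂ) * ((u ^ (3 / 2 : ℝ) : ℝ) : ℂ) = 1 := by
    rw [← ofReal_mul, Real.rpow_neg hu.le, inv_mul_cancel₀ (Real.rpow_pos_of_pos hu _).ne',
      ofReal_one]
  rw [← hu_def, ← hτ_def, ← hg]
  unfold tsqDual
  rw [hT, cpow_add _ _ huc, h32, ofReal_mul]
  linear_combination (((τ ^ (-(3 / 2 : ℝ)) : ℝ) : ℂ) * R (-t) *
    ((u : ℝ) : ℂ) ^ (I * (((-γ : ℝ)) : ℂ))) * hinv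

/-- The singular-branch factor `t ↦ (−σ_q(−t))^{−3/2}·g(−t)` is smooth on `(−q − ε, −q + ε)` when
`g` is smooth on `(q − ε, q + ε)` and `σ_q < 0` there (so the dual function is ingoing-type at
`−q` in the sense of CTdC Definition 3.3 at spin `+3/2`).
[cite: CasalsTeixeiradacosta2022, Definition 3.3] -/
theorem contDiffOn_tsqDual_singular_factor {d₁ d₂ d₄ q ε : ℝ} {g : ℝ → ℂ}
    (hg : ContDiffOn ℝ ((⊤ : ℕ∞) : WithTop ℕ∞) g (Ioo (q - ε) (q + ε)))
    (hσ : ∀ x ∈ Ioo (q - ε) (q + ε), tsqCofactor d₁ d₂ d₄ q x < 0) :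
    ContDiffOn ℝ ((⊤ : ℕ∞) : WithTop ℕ∞)
      (fun t => (((-tsqCofactor d₁ d₂ d₄ q (-t)) ^ (-(3 / 2 : ℝ)) : ℝ) : ℂ) * g (-t))
      (Ioo (-q - ε) (-q + ε)) := by
  have hmaps : MapsTo (fun t : ℝ => -t) (Ioo (-q - ε) (-q + ε)) (Ioo (q - ε) (q + ε)) := by
    intro t ht; exact ⟨by linarith [ht.2], by linarith [ht.1]⟩
  have h1 : ContDiffOn ℝ ((⊤ : ℕ∞) : WithTop ℕ∞) (fun t => -tsqCofactor d₁ d₂ d₄ q (-t))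
      (Ioo (-q - ε) (-q + ε)) :=
    (((contDiff_tsqCofactor d₁ d₂ d₄ q).comp contDiff_neg).neg).contDiffOn
  have h2 := h1.rpow_const_of_ne (p := -(3 / 2 : ℝ))
    (fun t ht => (by linarith [hσ (-t) (hmaps ht)] : -tsqCofactor d₁ d₂ d₄ q (-t) ≠ 0))
  exact (Complex.ofRealCLM.contDiff.comp_contDiffOn h2).mul (hg.comp contDiff_neg.contDiffOn hmaps)

/-- **Regular-branch conversion.** At a root `q` approached from the right along a branch
`R(x)·(x − q)^{−3/2 + iγ} = f(x)` on `(q, q + ε)` (the ingoing branch at `r₊` at spin `−3/2`), with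
`σ_q > 0` there, the dual function satisfies on `(−q − ε, −q)` the regular-branch relation of
file III at `p = −q`: `S(t)·(p − t)^{−i(−γ)} = σ_q(−t)^{−3/2}·f(−t)`. [cite: WuYan2004, Appendix A,
(A4); CasalsTeixeiradacosta2022, Definition 3.3] -/
theorem tsqDual_regular_branch {d₀ d₁ d₂ d₄ q γ ε : ℝ} (hq : tsqDelta d₀ d₁ d₂ d₄ q = 0)
    {R f : ℝ → ℂ} (hRf : ∀ x ∈ Ioo q (q + ε),
      R x * ((x - q : ℝ) : ℂ) ^ ((((-(3 / 2) : ℝ)) : ℂ) + I * (γ : ℂ)) = f x)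
    (hσ : ∀ x ∈ Ioo q (q + ε), 0 < tsqCofactor d₁ d₂ d₄ q x) {t : ℝ}
    (ht : t ∈ Ioo (-q - ε) (-q)) :
    tsqDual d₀ d₁ d₂ d₄ R t * ((-q - t : ℝ) : ℂ) ^ (-(I * (((-γ : ℝ)) : ℂ))) =
      (((tsqCofactor d₁ d₂ d₄ q (-t)) ^ (-(3 / 2 : ℝ)) : ℝ) : ℂ) * f (-t) := by
  obtain ⟨ht1, ht2⟩ := ht
  have hx : -t ∈ Ioo q (q + ε) := ⟨by linarith, by linarith⟩
  obtain ⟨u, hu_def⟩ : ∃ u : ℝ, u = -q - t := ⟨_, rfl⟩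
  have hu : 0 < u := by rw [hu_def]; linarith
  obtain ⟨τ, hτ_def⟩ : ∃ τ : ℝ, τ = tsqCofactor d₁ d₂ d₄ q (-t) := ⟨_, rfl⟩
  have hτ : 0 < τ := by rw [hτ_def]; exact hσ (-t) hx
  have hΔx : tsqDelta d₀ d₁ d₂ d₄ (-t) = u * τ := by
    rw [tsqDelta_eq_mul_tsqCofactor hq, hu_def, hτ_def]; ring
  have hT : tsqDualT d₀ d₁ d₂ d₄ t = u ^ (-(3 / 2 : ℝ)) * τ ^ (-(3 / 2 : ℝ)) := by
    unfold tsqDualT; rw [hΔx]; exact Real.mul_rpow hu.le hτ.le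
  have huc : ((u : ℝ) : ℂ) ≠ 0 := by exact_mod_cast hu.ne'
  have hf := hRf (-t) hx
  rw [show -t - q = u by rw [hu_def]; ring] at hf
  have h32 : ((u : ℝ) : ℂ) ^ ((((-(3 / 2) : ℝ)) : ℂ)) = ((u ^ (-(3 / 2) : ℝ) : ℝ) : ℂ) :=
    (Complex.ofReal_cpow hu.le _).symm
  rw [← hu_def, ← hτ_def, ← hf, show -(I * (((-γ : ℝ)) : ℂ)) = I * (γ : ℂ) by push_cast; ring]
  unfold tsqDual
  rw [hT, cpow_add _ _ huc, h32, ofReal_mul]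
  ring

/-- The regular-branch factor `t ↦ σ_q(−t)^{−3/2}·f(−t)` is smooth on `(−q − ε, −q + ε)` when `f` is
smooth on `(q − ε, q + ε)` and `σ_q > 0` there (so the dual function is outgoing-type at `−q` in the
sense of CTdC Definition 3.3). [cite: CasalsTeixeiradacosta2022, Definition 3.3] -/
theorem contDiffOn_tsqDual_regular_factor {d₁ d₂ d₄ q ε : ℝ} {f : ℝ → ℂ}
    (hf : ContDiffOn ℝ ((⊤ : ℕ∞) : WithTop ℕ∞) f (Ioo (q - ε) (q + ε)))
    (hσ : ∀ x ∈ Ioo (q - ε) (q + ε), 0 < tsqCofactor d₁ d₂ d₄ q x) :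
    ContDiffOn ℝ ((⊤ : ℕ∞) : WithTop ℕ∞)
      (fun t => (((tsqCofactor d₁ d₂ d₄ q (-t)) ^ (-(3 / 2 : ℝ)) : ℝ) : ℂ) * f (-t))
      (Ioo (-q - ε) (-q + ε)) := by
  have hmaps : MapsTo (fun t : ℝ => -t) (Ioo (-q - ε) (-q + ε)) (Ioo (q - ε) (q + ε)) := by
    intro t ht; exact ⟨by linarith [ht.2], by linarith [ht.1]⟩
  have h1 : ContDiffOn ℝ ((⊤ : ℕ∞) : WithTop ℕ∞) (fun t => tsqCofactor d₁ d₂ d₄ q (-t))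
      (Ioo (-q - ε) (-q + ε)) :=
    ((contDiff_tsqCofactor d₁ d₂ d₄ q).comp contDiff_neg).contDiffOn
  have h2 := h1.rpow_const_of_ne (p := -(3 / 2 : ℝ)) (fun t ht => (hσ (-t) (hmaps ht)).ne')
  exact (Complex.ofRealCLM.contDiff.comp_contDiffOn h2).mul (hf.comp contDiff_neg.contDiffOn hmaps)

end Literature.Geometry.Lorentzian.KerrDeSitter

end
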